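import Literature.Algebra.Homology.DiscreteRepCoinduced
import Literature.Algebra.Homology.DiscreteRepOpenSubgroup
import Literature.Topology.Algebra.ProfiniteClosedSubgroupTransversal

/-!
# The restriction to a CLOSED subgroup of a co-induced module is co-induced, hence
# `Ext(k, –)`-acyclic (Serre, *Cohomologie galoisienne* I §2.5 via I §1.2 Prop. 1)

Topic `Algebra/Homology`; namespace `Literature.Algebra.Homology.DiscreteRep`.  Sequel of
`DiscreteRepCoinduced` (`coind k Γ V = LocallyConstant Γ V ∈ C_Γ`, `ext_triv_coind_eq_zero`) and
`DiscreteRepOpenSubgroup` (`resD k D : C_Γ ⥤ C_D`); the topological input is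
`Literature.Topology.Algebra.Subgroup.exists_isClosed_homeomorph_mul` (Serre I §1.2 Prop. 1: a closed
subgroup `D` of a profinite `Γ` admits a closed right transversal `T`, and multiplication is a
`D`-equivariant homeomorphism `D × T ≃ₜ Γ`).  Definitions with bodies and theorems; no named fact,
no instance, no `sorry`.

The open-subgroup file `DiscreteRepOpenSubgroupCoindRes` proves `Ext^{q+1}_{C_U}(k, Res_U CoInd_Γ V) = 0`
for `U` OPEN of finite index by the two Shapiro lemmas (`Coind_U^Γ ⊣ Res`).  For a CLOSED subgroup `D`
of infinite index (a decomposition group `D_v ≤ G_S`, say) that adjunction is not available; instead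
(Serre, I §2.5: «si `H` est un sous-groupe fermé de `G`, et si `A` est induit pour `G`, il est induit
pour `H`», proved from the decomposition `G ≃ H × G/H` of I §1.2 Prop. 1):

* §1 `lcCurryEquiv` — **currying locally constant maps over a compact factor**,
  `LocallyConstant (X × Y) V ≃ₗ[k] LocallyConstant X (LocallyConstant Y V)` (`Y` compact: a locally
  constant map on `X × Y` is locally constant in `x` uniformly in `y`, by the tube argument);
* §2 `resDCoindIso` — for a `D`-equivariant homeomorphism `e : D × T ≃ₜ Γ` (`T` compact),
  **`Res_D (coind k Γ V) ≅ coind k D (LocallyConstant T V)`** in `C_D`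
  (`f ↦ (d ↦ (t ↦ f (e (d, t))))`);
* §3 **`ext_triv_resD_coind_eq_zero_of_isClosed`** / **`ext_triv_resD_eq_zero_of_iso_coind_of_isClosed`**
  — for `Γ` profinite and `D ≤ Γ` closed: `Ext^{q+1}_{C_D}(k, Res_D M) = 0` whenever `M ≅ coind k Γ V`.

This is the acyclicity input that makes the comparison `Extⁿ_{C_Γ}(k, X) ≅ Hⁿ_cont(Γ, X)` of
`DiscreteRepStandardResolution` compatible with restriction to closed subgroups (sequel file
`DiscreteRepStandardResolutionClosedRestriction`).

## References
* J.-P. Serre, *Galois Cohomology*, Springer (1997), I §1.2 Proposition 1, I §2.5 (induced modules and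
  closed subgroups). [SerreGaloisCohomology1997]
* D. Harari, *Galois Cohomology and Class Field Theory* (2020), §4.3 Remark 4.24. [Harari2020]
-/

noncomputable section

universe u

namespace Literature.Algebra.Homology

namespace DiscreteRep

open CategoryTheory CategoryTheory.Limits CategoryTheory.Abelian
open scoped _root_.Topology

/-! ## §1 Currying locally constant maps over a compact factor -/

section Curry

variable {X Y : Type u} [TopologicalSpace X] [TopologicalSpace Y] {V : Type u}

/-- The slice `y ↦ f (x, y)` of a locally constant map on `X × Y`, as a locally constant map on `Y`.
[cite: SerreGaloisCohomology1997, I §2.5] -/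
def lcSlice (f : LocallyConstant (X × Y) V) (x : X) : LocallyConstant Y V :=
  f.comap ⟨fun y => (x, y), continuous_const.prodMk continuous_id⟩

/-- Formula for `lcSlice`. [cite: SerreGaloisCohomology1997, I §2.5] -/
@[simp]
theorem lcSlice_apply (f : LocallyConstant (X × Y) V) (x : X) (y : Y) : lcSlice f x y = f (x, y) := rfl

/-- **Uniform local constancy along a compact factor**: for `Y` compact and `f` locally constant on
`X × Y`, the slice map `x ↦ f (x, ·)` is locally constant (tube argument over the finitely many boxes
covering `{x} × Y`). [cite: SerreGaloisCohomology1997, I §2.5] -/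
theorem isLocallyConstant_lcSlice [CompactSpace Y] (f : LocallyConstant (X × Y) V) :
    IsLocallyConstant (lcSlice f) := by
  refine (IsLocallyConstant.iff_exists_open _).2 fun x₀ => ?_
  -- a box `U y ×ˢ W y ∋ (x₀, y)` on which `f` is constant, for every `y`
  have hbox : ∀ y : Y, ∃ U : Set X, ∃ W : Set Y, IsOpen U ∧ IsOpen W ∧ x₀ ∈ U ∧ y ∈ W ∧
      U ×ˢ W ⊆ f ⁻¹' {f (x₀, y)} := fun y => by
    have ho : IsOpen (f ⁻¹' {f (x₀, y)}) := f.isLocallyConstant.isOpen_fiber _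
    obtain ⟨U, W, hU, hW, hx, hy, hsub⟩ := isOpen_prod_iff.1 ho x₀ y rfl
    exact ⟨U, W, hU, hW, hx, hy, hsub⟩
  choose U W hU hW hxU hyW hsub using hbox
  obtain ⟨t, ht⟩ := CompactSpace.elim_nhds_subcover W fun y => (hW y).mem_nhds (hyW y)
  refine ⟨⋂ y ∈ t, U y, isOpen_biInter_finset fun y _ => hU y, Set.mem_iInter₂.2 fun y _ => hxU y,
    fun x hx => LocallyConstant.ext fun y => ?_⟩
  -- `y` lies in some `W yᵢ`, and both `(x, y)` and `(x₀, y)` lie in the box `U yᵢ ×ˢ W yᵢ`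
  have hy : y ∈ ⋃ z ∈ t, W z := ht ▸ Set.mem_univ y
  obtain ⟨z, hzt, hyz⟩ := Set.mem_iUnion₂.1 hy
  have h1 : f (x, y) = f (x₀, z) := hsub z ⟨Set.mem_iInter₂.1 hx z hzt, hyz⟩
  have h2 : f (x₀, y) = f (x₀, z) := hsub z ⟨hxU z, hyz⟩
  rw [lcSlice_apply, lcSlice_apply, h1, h2]

/-- **Curry** a locally constant map on `X × Y` (`Y` compact). [cite: SerreGaloisCohomology1997, I §2.5] -/
def lcCurry [CompactSpace Y] (f : LocallyConstant (X × Y) V) : LocallyConstant X (LocallyConstant Y V) :=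
  ⟨lcSlice f, isLocallyConstant_lcSlice f⟩

/-- Formula for `lcCurry`. [cite: SerreGaloisCohomology1997, I §2.5] -/
@[simp]
theorem lcCurry_apply_apply [CompactSpace Y] (f : LocallyConstant (X × Y) V) (x : X) (y : Y) :
    lcCurry f x y = f (x, y) := rfl

/-- **Uncurry** a locally constant map into locally constant maps (no compactness needed).
[cite: SerreGaloisCohomology1997, I §2.5] -/
def lcUncurry (F : LocallyConstant X (LocallyConstant Y V)) : LocallyConstant (X × Y) V :=
  ⟨fun p => F p.1 p.2, by
    refine (IsLocallyConstant.iff_exists_open _).2 fun p => ?_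
    obtain ⟨U, hU, hpU, hUc⟩ := F.isLocallyConstant.exists_open p.1
    obtain ⟨W, hW, hpW, hWc⟩ := (F p.1).isLocallyConstant.exists_open p.2
    refine ⟨U ×ˢ W, hU.prod hW, ⟨hpU, hpW⟩, fun p' hp' => ?_⟩
    have h1 : F p'.1 = F p.1 := hUc p'.1 hp'.1
    have h2 : F p.1 p'.2 = F p.1 p.2 := hWc p'.2 hp'.2
    change F p'.1 p'.2 = F p.1 p.2
    rw [h1, h2]⟩

/-- Formula for `lcUncurry`. [cite: SerreGaloisCohomology1997, I §2.5] -/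
@[simp]
theorem lcUncurry_apply (F : LocallyConstant X (LocallyConstant Y V)) (p : X × Y) :
    lcUncurry F p = F p.1 p.2 := rfl

variable (k : Type u) [CommRing k] [AddCommGroup V] [Module k V]

/-- **`LocallyConstant (X × Y) V ≃ₗ[k] LocallyConstant X (LocallyConstant Y V)`** for `Y` compact.
[cite: SerreGaloisCohomology1997, I §2.5] -/
def lcCurryEquiv [CompactSpace Y] :
    LocallyConstant (X × Y) V ≃ₗ[k] LocallyConstant X (LocallyConstant Y V) where
  toFun := lcCurry
  invFun := lcUncurry
  map_add' _ _ := rfl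
  map_smul' _ _ := rfl
  left_inv f := LocallyConstant.ext fun p => by simp
  right_inv F := rfl

/-- Formula for `lcCurryEquiv`. [cite: SerreGaloisCohomology1997, I §2.5] -/
@[simp]
theorem lcCurryEquiv_apply_apply_apply [CompactSpace Y] (f : LocallyConstant (X × Y) V) (x : X)
    (y : Y) : lcCurryEquiv k f x y = f (x, y) := rfl

end Curry

/-! ## §2 `Res_D (coind k Γ V) ≅ coind k D (LocallyConstant T V)` along `D × T ≃ₜ Γ` -/

section Iso

variable (k : Type u) {Γ : Type u} [CommRing k] [Group Γ] [TopologicalSpace Γ] [IsTopologicalGroup Γ]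
  [CompactSpace Γ] (D : Subgroup Γ) [CompactSpace D] {T : Type u} [TopologicalSpace T]
  [CompactSpace T]

omit [IsTopologicalGroup Γ] [CompactSpace Γ] [CompactSpace D] in
/-- The linear isomorphism `LocallyConstant Γ V ≃ₗ[k] LocallyConstant D (LocallyConstant T V)`,
`f ↦ (d ↦ (t ↦ f (e (d, t))))`, along a homeomorphism `e : D × T ≃ₜ Γ`.
[cite: SerreGaloisCohomology1997, I §2.5] -/
def resCoindLinearEquiv (e : D × T ≃ₜ Γ) (V : Type u) [AddCommGroup V] [Module k V] :
    LocallyConstant Γ V ≃ₗ[k] LocallyConstant D (LocallyConstant T V) :=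
  (LocallyConstant.congrLeftₗ k e.symm) ≪≫ₗ lcCurryEquiv k

omit [IsTopologicalGroup Γ] [CompactSpace Γ] [CompactSpace D] in
/-- Formula for `resCoindLinearEquiv`. [cite: SerreGaloisCohomology1997, I §2.5] -/
@[simp]
theorem resCoindLinearEquiv_apply_apply_apply (e : D × T ≃ₜ Γ) (V : Type u) [AddCommGroup V]
    [Module k V] (f : LocallyConstant Γ V) (d : D) (t : T) :
    resCoindLinearEquiv k D e V f d t = f (e (d, t)) := by
  simp [resCoindLinearEquiv, LocallyConstant.congrLeftₗ]

omit [CompactSpace Γ] [CompactSpace D] in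
/-- `resCoindLinearEquiv` intertwines the restriction to `D` of the co-induced action of `Γ` with the
co-induced action of `D` — this is where the `D`-equivariance `e (d d', t) = d · e (d', t)` enters.
[cite: SerreGaloisCohomology1997, I §2.5] -/
theorem resCoindLinearEquiv_comm (e : D × T ≃ₜ Γ)
    (he : ∀ (d d' : D) (t : T), e (d * d', t) = (d : Γ) * e (d', t)) (V : Type u) [AddCommGroup V]
    [Module k V] (d : D) :
    (resCoindLinearEquiv k D e V).toLinearMap ∘ₗ ((coindRepr k Γ V).comp D.subtype) d =
      (coindRepr k D (LocallyConstant T V)) d ∘ₗ (resCoindLinearEquiv k D e V).toLinearMap := by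
  refine LinearMap.ext fun f => LocallyConstant.ext fun d' => LocallyConstant.ext fun t => ?_
  change resCoindLinearEquiv k D e V (coindRepr k Γ V (d : Γ) f) d' t =
    (coindRepr k D (LocallyConstant T V) d (resCoindLinearEquiv k D e V f)) d' t
  rw [coindRepr_apply_apply, resCoindLinearEquiv_apply_apply_apply, coindRepr_apply_apply,
    resCoindLinearEquiv_apply_apply_apply, ← Subgroup.coe_inv, ← he]

omit [CompactSpace Γ] [CompactSpace D] in
/-- The equivalence of representations `Res_D (coindRepr k Γ V) ≃ coindRepr k D (LocallyConstant T V)`.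
[cite: SerreGaloisCohomology1997, I §2.5] -/
def resCoindReprEquiv (e : D × T ≃ₜ Γ)
    (he : ∀ (d d' : D) (t : T), e (d * d', t) = (d : Γ) * e (d', t)) (V : Type u) [AddCommGroup V]
    [Module k V] :
    Representation.Equiv ((coindRepr k Γ V).comp D.subtype) (coindRepr k D (LocallyConstant T V)) :=
  Representation.Equiv.mk (resCoindLinearEquiv k D e V) (resCoindLinearEquiv_comm k D e he V)

/-- **`Res_D (coind k Γ V) ≅ coind k D (LocallyConstant T V)` in `C_D`** along a `D`-equivariant
homeomorphism `D × T ≃ₜ Γ`. [cite: SerreGaloisCohomology1997, I §2.5] -/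
def resDCoindIso (e : D × T ≃ₜ Γ)
    (he : ∀ (d d' : D) (t : T), e (d * d', t) = (d : Γ) * e (d', t)) (V : Type u) [AddCommGroup V]
    [Module k V] : (resD k D).obj (coind k Γ V) ≅ coind k D (LocallyConstant T V) :=
  (isDiscrete k D).isoMk (Rep.mkIso (resCoindReprEquiv k D e he V))

/-- Formula for `resDCoindIso`. [cite: SerreGaloisCohomology1997, I §2.5] -/
@[simp]
theorem resDCoindIso_hom_apply (e : D × T ≃ₜ Γ)
    (he : ∀ (d d' : D) (t : T), e (d * d', t) = (d : Γ) * e (d', t)) (V : Type u) [AddCommGroup V]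
    [Module k V] (f : LocallyConstant Γ V) (d : D) (t : T) :
    ((resDCoindIso k D e he V).hom.hom.hom f : LocallyConstant D (LocallyConstant T V)) d t =
      f (e (d, t)) := by
  change resCoindLinearEquiv k D e V f d t = _
  exact resCoindLinearEquiv_apply_apply_apply k D e V f d t

/-- **`Ext^{q+1}_{C_D}(k, Res_D (coind k Γ V)) = 0`** along a `D`-equivariant decomposition
`D × T ≃ₜ Γ`. [cite: SerreGaloisCohomology1997, I §2.5] -/
theorem ext_triv_resD_coind_eq_zero_of_homeomorph (e : D × T ≃ₜ Γ)
    (he : ∀ (d d' : D) (t : T), e (d * d', t) = (d : Γ) * e (d', t)) (V : Type u) [AddCommGroup V]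
    [Module k V] (q : ℕ)
    (x : Ext (triv (k := k) (Γ := D) k) ((resD k D).obj (coind k Γ V)) (q + 1)) : x = 0 :=
  ext_triv_eq_zero_of_iso_coind (resDCoindIso k D e he V) q x

end Iso

/-! ## §3 Closed subgroups of profinite groups -/

section Closed

variable {k Γ : Type u} [CommRing k] [Group Γ] [TopologicalSpace Γ] [IsTopologicalGroup Γ]
  [CompactSpace Γ] [TotallyDisconnectedSpace Γ] (D : Subgroup Γ) (hD : IsClosed (D : Set Γ))

include hD in
/-- **`Ext^{q+1}_{C_D}(k, Res_D (coind k Γ V)) = 0` for `D` a CLOSED subgroup of a profinite `Γ`.**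
(`CompactSpace D` is a hypothesis only to state `C_D`-objects uniformly; it follows from `hD`.)
[cite: SerreGaloisCohomology1997, I §2.5 and I §1.2 Proposition 1] -/
theorem ext_triv_resD_coind_eq_zero_of_isClosed [CompactSpace D] (V : Type u) [AddCommGroup V]
    [Module k V] (q : ℕ) (x : Ext (triv (k := k) (Γ := D) k) ((resD k D).obj (coind k Γ V)) (q + 1)) :
    x = 0 := by
  obtain ⟨T, hTc, e, he⟩ :=
    Literature.Topology.Algebra.Subgroup.exists_isClosed_homeomorph_mul D hD
  haveI : CompactSpace T := isCompact_iff_compactSpace.1 hTc.isCompact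
  have he' : ∀ (d d' : D) (t : T), e (d * d', t) = (d : Γ) * e (d', t) := fun d d' t => by
    rw [he, he, Subgroup.coe_mul, mul_assoc]
  exact ext_triv_resD_coind_eq_zero_of_homeomorph k D e he' V q x

include hD in
/-- **Transport**: for `M ≅ coind k Γ V` in `C_Γ` and `D ≤ Γ` closed (`Γ` profinite),
`Ext^{q+1}_{C_D}(k, Res_D M) = 0` — the restriction to a closed subgroup of an induced module is
acyclic. [cite: SerreGaloisCohomology1997, I §2.5] -/
theorem ext_triv_resD_eq_zero_of_iso_coind_of_isClosed [CompactSpace D] {M : DiscreteRepCat k Γ}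
    {V : Type u} [AddCommGroup V] [Module k V] (i : M ≅ coind k Γ V) (q : ℕ)
    (x : Ext (triv (k := k) (Γ := D) k) ((resD k D).obj M) (q + 1)) : x = 0 := by
  have h : x.comp (Ext.mk₀ ((resD k D).map i.hom)) (add_zero _) = 0 :=
    ext_triv_resD_coind_eq_zero_of_isClosed D hD V q _
  have := congrArg (fun y => y.comp (Ext.mk₀ ((resD k D).map i.inv)) (add_zero _)) h
  simpa only [Ext.comp_assoc_of_second_deg_zero, Ext.mk₀_comp_mk₀, ← CategoryTheory.Functor.map_comp,
    Iso.hom_inv_id, CategoryTheory.Functor.map_id, Ext.comp_mk₀_id, Ext.zero_comp] using this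

end Closed

end DiscreteRep

end Literature.Algebra.Homology
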